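import Literature.AnabelianGeometry.EtaleTheta.SettingModelSemidirect
import Literature.AnabelianGeometry.SemiGraphs.TemperedAnabelian
import Literature.AnabelianGeometry.SemiGraphs.ProfiniteCompletionEta
import Literature.AnabelianGeometry.AbsoluteAnabelian.AbsTopI.CharOpenBasis

/-!
# Topology on a semidirect product `N ⋊_φ G`: topological-group criterion, joint continuity of the
# action, and profinite completion along the normal factor

Mochizuki, *The étale theta function …*, Publ. RIMS **45** (2009) [EtTh], §1, PRIMS PDF pp. 11–13
[cite: MochizukiEtTh2009, §1 p.12]: "`Π^tp_X`", "`Π_X := (Π^tp_X)^∧`", the extension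
`1 → Δ^tp_X → Π^tp_X → G_K → 1`.  abc-iut cell, layer L2, R78 cluster (the χ-TWISTED root model of the [EtTh] §1
setting, `Π^tp_X := (F̂₂ ×_Ẑ ℤ) ⋊_χ G_{ℚ_p}`), hand F4 = seat abc-iut-w5-d249, GENERIC half (no model import):
the topological plumbing Mathlib's `SemidirectProduct` lacks, for ANY `N ⋊[φ] G` topologised so that
`g ↦ (g.left, g.right)` is INDUCING (hypothesis `hι`, as in abc-iut-L2-t1's `SettingModelSemidirect`):

* T1/T2/T4/T5 — `continuous_left/right`, `homeomorphProd`, `continuous_inl/inr`, `rightHomCont`, `isOpenMap_right`,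
  and compactness / Hausdorffness / total disconnectedness inherited from `N × G`;
* T3 `isTopologicalGroup_of_continuous_action` — `N ⋊[φ] G` is a topological group as soon as the action map
  `(g, n) ↦ φ g n` is JOINTLY continuous;
* T6 `continuous_action_of_pointwise` — for `N` profinite and topologically finitely generated, an action by
  continuous automorphisms that is SEPARATELY continuous in `g` is jointly continuous (uniformity from a
  CHARACTERISTIC open normal subgroup, `AbsTopI/CharOpenBasis.exists_charOpen_normal_le`);
* T7 `isProfiniteCompletion_mapCont` — if `ιN : N → N̂` is a profinite completion compatible with actions
  `φ`, `φ̂` of a profinite `G`, then `ιN ⋊ id : N ⋊_φ G → N̂ ⋊_φ̂ G` is a profinite completion (the [EtTh]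
  sentence "`Π_X := (Π^tp_X)^∧`" for a twisted model): an open normal finite-index `U` contains the twisted
  product of its slices (abc-iut-L2-t1's `twistedProd`, normal because `B := U ∩ G` acts trivially on `N/(U ∩ N)`),
  whose completion-side counterpart is open normal, then `IsProfiniteCompletion.exists_openNormal_comap_eq`.

Plain topology/group theory; nothing here asserts anything about [EtTh]'s curves; semi-synthetic-model
support = consistency evidence only; nothing bears on [IUTchIII] Cor. 3.12.
-/

noncomputable section

namespace Literature.AnabelianGeometry.EtaleTheta.SettingModel.Semidirect

open Topology Function Literature.AnabelianGeometry.SemiGraphs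
open Literature.AnabelianGeometry.AbsoluteAnabelian

variable {N G : Type*} [Group N] [Group G] {φ : G →* MulAut N}
  [TopologicalSpace N] [TopologicalSpace G] [TopologicalSpace (N ⋊[φ] G)]

/-! ### T1/T2: the inducing map `g ↦ (g.left, g.right)` -/

section Inducing

variable (hι : IsInducing fun g : N ⋊[φ] G => (g.left, g.right))
include hι

/-- `left` is continuous. [cite: MochizukiEtTh2009, §1 p.12] -/
theorem continuous_left : Continuous fun g : N ⋊[φ] G => g.left := continuous_fst.comp hι.continuous

/-- `right` is continuous. [cite: MochizukiEtTh2009, §1 p.12] -/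
theorem continuous_right : Continuous fun g : N ⋊[φ] G => g.right := continuous_snd.comp hι.continuous

/-- A map INTO `N ⋊[φ] G` is continuous iff its two components are. [cite: MochizukiEtTh2009, §1 p.12] -/
theorem continuous_iff_left_right {X : Type*} [TopologicalSpace X] {f : X → N ⋊[φ] G} :
    Continuous f ↔ Continuous (fun x => (f x).left) ∧ Continuous (fun x => (f x).right) := by
  rw [hι.continuous_iff]
  constructor
  · intro h
    exact ⟨continuous_fst.comp h, continuous_snd.comp h⟩
  · rintro ⟨h1, h2⟩
    exact h1.prodMk h2

/-- `N ⋊[φ] G ≃ₜ N × G` (the set-theoretic `SemidirectProduct.equivProd`, a homeomorphism because the topology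
is induced along it). [cite: MochizukiEtTh2009, §1 p.12] -/
def homeomorphProd : N ⋊[φ] G ≃ₜ N × G where
  toEquiv := SemidirectProduct.equivProd
  continuous_toFun := hι.continuous
  continuous_invFun := by
    rw [hι.continuous_iff]
    exact continuous_id

/-- [cite: MochizukiEtTh2009, §1 p.12] -/
@[simp] theorem homeomorphProd_apply (g : N ⋊[φ] G) : homeomorphProd hι g = (g.left, g.right) := rfl

/-- [cite: MochizukiEtTh2009, §1 p.12] -/
@[simp] theorem homeomorphProd_symm_apply (q : N × G) : (homeomorphProd hι).symm q = ⟨q.1, q.2⟩ := rfl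

/-- `inl : N → N ⋊[φ] G` is continuous. [cite: MochizukiEtTh2009, §1 p.12] -/
theorem continuous_inl : Continuous (SemidirectProduct.inl : N → N ⋊[φ] G) :=
  (continuous_iff_left_right hι).2 ⟨continuous_id, continuous_const⟩

/-- `inr : G → N ⋊[φ] G` is continuous. [cite: MochizukiEtTh2009, §1 p.12] -/
theorem continuous_inr : Continuous (SemidirectProduct.inr : G → N ⋊[φ] G) :=
  (continuous_iff_left_right hι).2 ⟨continuous_const, continuous_id⟩

/-- `right : N ⋊[φ] G → G` is an OPEN map (a coordinate projection up to homeomorphism).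
[cite: MochizukiEtTh2009, §1 p.12] -/
theorem isOpenMap_right : IsOpenMap fun g : N ⋊[φ] G => g.right := by
  have : (fun g : N ⋊[φ] G => g.right) = Prod.snd ∘ homeomorphProd hι := rfl
  rw [this]
  exact isOpenMap_snd.comp (homeomorphProd hι).isOpenMap

/-- The projection `N ⋊[φ] G → G` as a continuous homomorphism (the augmentation of a twisted model).
[cite: MochizukiEtTh2009, §1 p.12] -/
def rightHomCont : N ⋊[φ] G →ₜ* G :=
  { (SemidirectProduct.rightHom : N ⋊[φ] G →* G) with continuous_toFun := continuous_right hι }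

/-- [cite: MochizukiEtTh2009, §1 p.12] -/
@[simp] theorem rightHomCont_apply (g : N ⋊[φ] G) : rightHomCont hι g = g.right := rfl

/-- `N ⋊[φ] G` is compact if `N` and `G` are. [cite: MochizukiEtTh2009, §1 p.12] -/
theorem compactSpace_of [CompactSpace N] [CompactSpace G] : CompactSpace (N ⋊[φ] G) :=
  (homeomorphProd hι).symm.compactSpace

/-- `N ⋊[φ] G` is Hausdorff if `N` and `G` are. [cite: MochizukiEtTh2009, §1 p.12] -/
theorem t2Space_of [T2Space N] [T2Space G] : T2Space (N ⋊[φ] G) :=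
  (homeomorphProd hι).symm.t2Space

/-- `N ⋊[φ] G` is totally disconnected if `N` and `G` are. [cite: MochizukiEtTh2009, §1 p.12] -/
theorem totallyDisconnectedSpace_of [TotallyDisconnectedSpace N] [TotallyDisconnectedSpace G] :
    TotallyDisconnectedSpace (N ⋊[φ] G) :=
  (homeomorphProd hι).symm.totallyDisconnectedSpace

/-! ### T3: topological group structure from a jointly continuous action -/

/-- **`N ⋊[φ] G` is a topological group** when `N`, `G` are and the action `(g, n) ↦ φ g n` is JOINTLY
continuous: `(a b).left = a.left · φ a.right b.left`, `(a⁻¹).left = φ a.right⁻¹ a.left⁻¹`.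
[cite: MochizukiEtTh2009, §1 p.12] -/
theorem isTopologicalGroup_of_continuous_action [IsTopologicalGroup N] [IsTopologicalGroup G]
    (hφ : Continuous fun q : G × N => φ q.1 q.2) : IsTopologicalGroup (N ⋊[φ] G) where
  continuous_mul := by
    refine (continuous_iff_left_right hι).2 ⟨?_, ?_⟩
    · change Continuous fun q : (N ⋊[φ] G) × (N ⋊[φ] G) => q.1.left * φ q.1.right q.2.left
      exact ((continuous_left hι).comp continuous_fst).mul
        (hφ.comp (((continuous_right hι).comp continuous_fst).prodMk ((continuous_left hι).comp continuous_snd)))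
    · change Continuous fun q : (N ⋊[φ] G) × (N ⋊[φ] G) => q.1.right * q.2.right
      exact ((continuous_right hι).comp continuous_fst).mul ((continuous_right hι).comp continuous_snd)
  continuous_inv := by
    refine (continuous_iff_left_right hι).2 ⟨?_, ?_⟩
    · change Continuous fun g : N ⋊[φ] G => φ g.right⁻¹ g.left⁻¹
      exact hφ.comp ((continuous_right hι).inv.prodMk (continuous_left hι).inv)
    · change Continuous fun g : N ⋊[φ] G => g.right⁻¹
      exact (continuous_right hι).inv

end Inducing

/-! ### T6: joint continuity of the action from pointwise continuity (profinite, topologically f.g. `N`) -/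

omit [TopologicalSpace (N ⋊[φ] G)] in
/-- **Joint continuity criterion.**  Let `N` be a profinite, topologically finitely generated topological group
on which `G` acts by continuous automorphisms `φ g`, and suppose each orbit map `g ↦ φ g n` is continuous.
Then `(g, n) ↦ φ g n` is jointly continuous.  (Uniformity: inside any open normal `V` there is a
CHARACTERISTIC open normal `W` — `exists_charOpen_normal_le` — and `φ g (n₀ W) = (φ g n₀) W` for all `g`.)
[cite: MochizukiEtTh2009, §1 p.12] -/
theorem continuous_action_of_pointwise [IsTopologicalGroup N] [CompactSpace N] [T2Space N]
    [TotallyDisconnectedSpace N] (hN : IsTopologicallyFinitelyGenerated N) (hc : ∀ g : G, Continuous (φ g))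
    (hpt : ∀ n : N, Continuous fun g : G => φ g n) : Continuous fun q : G × N => φ q.1 q.2 := by
  refine continuous_iff_continuousAt.2 fun ⟨g₀, n₀⟩ => ?_
  rw [ContinuousAt, Filter.tendsto_def]
  intro U hU
  -- an open normal subgroup `V` with `(φ g₀ n₀) · V ⊆ U`
  set y₀ : N := φ g₀ n₀ with hy₀
  have hO : (fun z => y₀ * z) ⁻¹' U ∈ 𝓝 (1 : N) := by
    have hc0 : Continuous fun z : N => y₀ * z := continuous_const.mul continuous_id
    exact hc0.continuousAt.preimage_mem_nhds (by simpa using hU)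
  obtain ⟨O, hOU, hOo, h1O⟩ := mem_nhds_iff.mp hO
  obtain ⟨V, hV⟩ := ProfiniteGrp.exist_openNormalSubgroup_sub_open_nhds_of_one hOo h1O
  haveI : V.toSubgroup.FiniteIndex := by
    haveI : Finite (N ⧸ V.toSubgroup) := Subgroup.quotient_finite_of_isOpen _ V.isOpen'
    exact Subgroup.finiteIndex_of_finite_quotient
  -- a characteristic open normal `W ≤ V`
  obtain ⟨W, -, hWo, -, hWchar, hWV⟩ := hN.exists_charOpen_normal_le V.toSubgroup V.isOpen'
  -- `W` is stable under every `φ g`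
  have hstab : ∀ (g : G) {w : N}, w ∈ W → φ g w ∈ W := by
    intro g w hw
    let e : N ≃ₜ* N :=
      { (φ g : N ≃* N) with
        continuous_toFun := hc g
        continuous_invFun := by
          have : Continuous (φ g⁻¹) := hc g⁻¹
          rw [map_inv] at this
          exact this }
    have hWe := hWchar e
    rw [← hWe]
    exact ⟨w, hw, rfl⟩
  -- the neighbourhoods `S ∋ g₀`, `T ∋ n₀`
  let S : Set G := (fun g => y₀⁻¹ * φ g n₀) ⁻¹' (W : Set N)
  let T : Set N := (fun n => n₀⁻¹ * n) ⁻¹' (W : Set N)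
  have hS : S ∈ 𝓝 g₀ := by
    refine (hWo.preimage (continuous_const.mul (hpt n₀))).mem_nhds ?_
    change y₀⁻¹ * φ g₀ n₀ ∈ W
    rw [hy₀, inv_mul_cancel]
    exact W.one_mem
  have hT : T ∈ 𝓝 n₀ := by
    refine (hWo.preimage (continuous_const.mul continuous_id)).mem_nhds ?_
    change n₀⁻¹ * n₀ ∈ W
    rw [inv_mul_cancel]
    exact W.one_mem
  refine Filter.mem_of_superset (prod_mem_nhds hS hT) ?_
  rintro ⟨g, n⟩ ⟨hg, hn⟩
  change y₀⁻¹ * φ g n₀ ∈ W at hg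
  change n₀⁻¹ * n ∈ W at hn
  -- `y₀⁻¹ · φ g n = (y₀⁻¹ · φ g n₀) · φ g (n₀⁻¹ n) ∈ W ⊆ V ⊆ O`
  have hmem : y₀⁻¹ * φ g n ∈ W := by
    have e : y₀⁻¹ * φ g n = (y₀⁻¹ * φ g n₀) * φ g (n₀⁻¹ * n) := by
      rw [map_mul, map_inv]; group
    rw [e]
    exact W.mul_mem hg (hstab g hn)
  change φ g n ∈ U
  have : y₀ * (y₀⁻¹ * φ g n) ∈ U := hOU (hV (hWV hmem))
  simpa using this

/-! ### T7: profinite completion along the normal factor -/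

section Completion

variable {Nh : Type*} [Group Nh] [TopologicalSpace Nh] {φh : G →* MulAut Nh} [TopologicalSpace (Nh ⋊[φh] G)]
  (hι : IsInducing fun g : N ⋊[φ] G => (g.left, g.right))
  (hι' : IsInducing fun g : Nh ⋊[φh] G => (g.left, g.right))
  (ιN : N →ₜ* Nh) (hcomp : ∀ (g : G) (n : N), ιN (φ g n) = φh g (ιN n))

/-- `ιN ⋊ id : N ⋊_φ G → N̂ ⋊_φ̂ G` for `ιN` compatible with the two actions, as a continuous homomorphism.
[cite: MochizukiEtTh2009, §1 p.12] -/
def mapCont : N ⋊[φ] G →ₜ* Nh ⋊[φh] G :=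
  { SemidirectProduct.map ιN.toMonoidHom (MonoidHom.id G) (fun g => MonoidHom.ext fun n => hcomp g n) with
    continuous_toFun := by
      refine (continuous_iff_left_right hι').2 ⟨?_, ?_⟩
      · exact ιN.continuous.comp (continuous_left hι)
      · exact continuous_right hι }

/-- [cite: MochizukiEtTh2009, §1 p.12] -/
@[simp] theorem mapCont_left (g : N ⋊[φ] G) : (mapCont hι hι' ιN hcomp g).left = ιN g.left := rfl

/-- [cite: MochizukiEtTh2009, §1 p.12] -/
@[simp] theorem mapCont_right (g : N ⋊[φ] G) : (mapCont hι hι' ιN hcomp g).right = g.right := rfl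

/-- `ιN ⋊ id` is injective when `ιN` is. [cite: MochizukiEtTh2009, §1 p.12] -/
theorem mapCont_injective (hinj : Injective ιN) : Injective (mapCont hι hι' ιN hcomp) := by
  intro a b h
  have h1 := congrArg SemidirectProduct.left h
  have h2 := congrArg SemidirectProduct.right h
  simp only [mapCont_left, mapCont_right] at h1 h2
  exact SemidirectProduct.ext (hinj h1) h2

/-- `ιN ⋊ id` has dense range when `ιN` has. [cite: MochizukiEtTh2009, §1 p.12] -/
theorem denseRange_mapCont (hd : DenseRange ιN) : DenseRange (mapCont hι hι' ιN hcomp) := by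
  have e : (mapCont hι hι' ιN hcomp : N ⋊[φ] G → Nh ⋊[φh] G) =
      (homeomorphProd hι').symm ∘ Prod.map ιN id ∘ homeomorphProd hι := by
    funext g; rfl
  rw [e]
  refine DenseRange.comp ?_ ((hd.prodMap denseRange_id).comp (homeomorphProd hι).surjective.denseRange
    (ιN.continuous.prodMap continuous_id)) (homeomorphProd hι').symm.continuous
  exact (homeomorphProd hι').symm.surjective.denseRange

/-- An open subgroup `V ≤ N̂` whose preimage is `A` lies inside the closure of `ιN(A)` (`ιN` dense): used to see
that such a `V` is stable under every continuous `φ̂ g` once `A` is `φ`-stable.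
[cite: MochizukiEtTh2009, §1 p.12] -/
theorem subset_closure_image_of_comap_eq (hd : DenseRange ιN) {V : Subgroup Nh} (hVo : IsOpen (V : Set Nh))
    {A : Subgroup N} (hVA : V.comap ιN.toMonoidHom = A) : (V : Set Nh) ⊆ closure (ιN '' (A : Set N)) := by
  have h := hd.open_subset_closure_inter hVo
  have e : (V : Set Nh) ∩ Set.range ιN = ιN '' (A : Set N) := by
    ext v
    constructor
    · rintro ⟨hv, n, rfl⟩
      exact ⟨n, by rw [← hVA]; exact hv, rfl⟩
    · rintro ⟨n, hn, rfl⟩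
      rw [← hVA] at hn
      exact ⟨hn, n, rfl⟩
  rwa [e] at h

variable [IsTopologicalGroup Nh]

/-- **`ιN ⋊ id : N ⋊_φ G → N̂ ⋊_φ̂ G` is a profinite completion** when `ιN` is one, `G` is profinite, the actions
are compatible and each `φ̂ g` is continuous ("`Π_X := (Π^tp_X)^∧`" for a twisted model).  Open normal `U` of
finite index ⊇ `twistedProd (U ∩ N) (U ∩ G)`; `U ∩ N = ιN⁻¹(V)` with `V` open normal, `φ̂`-stable (it lies in the
closure of `ιN(U ∩ N)`), and `U ∩ G` acts trivially on `N̂/V` (by density, since `[n, b] ∈ U`); so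
`K := twistedProd V (U ∩ G)` is open normal with preimage `≤ U`, and `exists_openNormal_comap_eq` concludes.
[cite: MochizukiEtTh2009, §1 p.12] -/
theorem isProfiniteCompletion_mapCont (hN : IsProfiniteCompletion ιN) (hch : ∀ g : G, Continuous (φh g))
    [CompactSpace G] [T2Space G] [TotallyDisconnectedSpace G] [IsTopologicalGroup (Nh ⋊[φh] G)] :
    IsProfiniteCompletion (mapCont hι hι' ιN hcomp) := by
  haveI := hN.compactSpace; haveI := hN.t2Space; haveI := hN.totallyDisconnectedSpace
  haveI := compactSpace_of hι'; haveI := t2Space_of hι'; haveI := totallyDisconnectedSpace_of hι'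
  have hdense := denseRange_mapCont hι hι' ιN hcomp hN.denseRange
  refine
    { compactSpace := inferInstance
      t2Space := inferInstance
      totallyDisconnectedSpace := inferInstance
      denseRange := hdense
      comap_surjective := fun U hUfi => ?_
      isOpen_comap := fun V => V.isOpen'.preimage (mapCont hι hι' ιN hcomp).continuous }
  haveI hUn : U.toSubgroup.Normal := U.isNormal'
  haveI : U.toSubgroup.FiniteIndex := hUfi
  -- the slices `A := U ∩ N`, `B := U ∩ G`
  let A : Subgroup N := U.toSubgroup.comap (SemidirectProduct.inl : N →* N ⋊[φ] G)
  let B : Subgroup G := U.toSubgroup.comap (SemidirectProduct.inr : G →* N ⋊[φ] G)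
  have hAo : IsOpen (A : Set N) := U.isOpen'.preimage (continuous_inl hι)
  have hBo : IsOpen (B : Set G) := U.isOpen'.preimage (continuous_inr hι)
  haveI hAn : A.Normal := Subgroup.Normal.comap inferInstance _
  haveI hBn : B.Normal := Subgroup.Normal.comap inferInstance _
  have hAf : A.FiniteIndex := by
    refine ⟨fun h0 => ?_⟩
    have hd := Subgroup.relIndex_dvd_index_of_normal U.toSubgroup (SemidirectProduct.inl : N →* N ⋊[φ] G).range
    rw [← Subgroup.index_comap] at hd
    exact hUfi.index_ne_zero (Nat.eq_zero_of_zero_dvd (h0 ▸ hd))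
  -- `A` is stable under ALL of `φ(G)`: `inl (φ g a) = inr g · inl a · (inr g)⁻¹ ∈ U`
  have hAstab : ∀ (g : G) {a : N}, a ∈ A → φ g a ∈ A := by
    intro g a ha
    change SemidirectProduct.inl (φ g a) ∈ U.toSubgroup
    rw [SemidirectProduct.inl_aut, map_inv]
    exact hUn.conj_mem _ ha _
  -- `B` acts trivially on `N/A`: `inl (n (φ b n)⁻¹) = (inl n · inr b · (inl n)⁻¹) · (inr b)⁻¹ ∈ U`
  have hBtriv : ∀ {b : G}, b ∈ B → ∀ n : N, n * (φ b n)⁻¹ ∈ A := by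
    intro b hb n
    change SemidirectProduct.inl (n * (φ b n)⁻¹) ∈ U.toSubgroup
    have e : (SemidirectProduct.inl (n * (φ b n)⁻¹) : N ⋊[φ] G) =
        (SemidirectProduct.inl n * SemidirectProduct.inr b * (SemidirectProduct.inl n)⁻¹) *
          (SemidirectProduct.inr b)⁻¹ := by
      rw [map_mul, map_inv, SemidirectProduct.inl_aut, map_inv]; group
    rw [e]
    exact U.toSubgroup.mul_mem (hUn.conj_mem _ hb _) (U.toSubgroup.inv_mem hb)
  -- `A = ιN⁻¹(V)` for an open normal `V ≤ N̂`
  obtain ⟨V, hV⟩ := hN.comap_surjective ⟨⟨A, hAo⟩, hAn⟩ hAf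
  change A = V.toSubgroup.comap ιN.toMonoidHom at hV
  haveI : V.toSubgroup.Normal := V.isNormal'
  have hVcl : IsClosed (V.toSubgroup : Set Nh) := V.toSubgroup.isClosed_of_isOpen V.isOpen'
  have hVsub : (V.toSubgroup : Set Nh) ⊆ closure (ιN '' (A : Set N)) :=
    subset_closure_image_of_comap_eq ιN hN.denseRange V.isOpen' hV.symm
  -- `V` is `φ̂`-stable
  have hVstab : ∀ (g : G) ⦃v : Nh⦄, v ∈ V.toSubgroup → φh g v ∈ V.toSubgroup := by
    intro g v hv
    have h1 : φh g v ∈ closure (φh g '' (ιN '' (A : Set N))) :=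
      image_closure_subset_closure_image (hch g) ⟨v, hVsub hv, rfl⟩
    have h2 : φh g '' (ιN '' (A : Set N)) ⊆ (V.toSubgroup : Set Nh) := by
      rintro _ ⟨_, ⟨a, ha, rfl⟩, rfl⟩
      have : φ g a ∈ A := hAstab g ha
      rw [hV] at this
      change ιN (φ g a) ∈ V.toSubgroup at this
      rwa [hcomp] at this
    exact closure_minimal h2 hVcl h1
  -- `B` acts trivially on `N̂/V` (by density)
  have hVtriv : ∀ ⦃b : G⦄, b ∈ B → ∀ x : Nh, x * (φh b x)⁻¹ ∈ V.toSubgroup := by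
    intro b hb x
    have hfc : Continuous fun x : Nh => x * (φh b x)⁻¹ := continuous_id.mul (hch b).inv
    have h1 : x * (φh b x)⁻¹ ∈ closure ((fun x : Nh => x * (φh b x)⁻¹) '' Set.range ιN) :=
      image_closure_subset_closure_image hfc ⟨x, hN.denseRange x, rfl⟩
    have h2 : (fun x : Nh => x * (φh b x)⁻¹) '' Set.range ιN ⊆ (V.toSubgroup : Set Nh) := by
      rintro _ ⟨_, ⟨n, rfl⟩, rfl⟩
      have : n * (φ b n)⁻¹ ∈ A := hBtriv hb n
      rw [hV] at this
      change ιN (n * (φ b n)⁻¹) ∈ V.toSubgroup at this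
      rwa [map_mul, map_inv, hcomp] at this
    exact closure_minimal h2 hVcl h1
  -- `K := V ⋊ B`, open normal in `N̂ ⋊ G`, with preimage `≤ U`
  let K₀ : Subgroup (Nh ⋊[φh] G) := twistedProd V.toSubgroup B (stable_of_forall hVstab B)
  haveI hK₀n : K₀.Normal := twistedProd_normal hVstab hVtriv
  have hK₀o : IsOpen (K₀ : Set (Nh ⋊[φh] G)) := isOpen_twistedProd hι'.continuous V.isOpen' hBo
  let K : OpenNormalSubgroup (Nh ⋊[φh] G) := ⟨⟨K₀, hK₀o⟩, hK₀n⟩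
  have hKU : K.toSubgroup.comap (mapCont hι hι' ιN hcomp).toMonoidHom ≤ U.toSubgroup := by
    intro g hg
    have hg' : (mapCont hι hι' ιN hcomp g).left ∈ V.toSubgroup ∧ (mapCont hι hι' ιN hcomp g).right ∈ B := hg
    obtain ⟨h1, h2⟩ := hg'
    have ha : g.left ∈ A := by
      rw [hV]
      exact h1
    have h2' : SemidirectProduct.inr g.right ∈ U.toSubgroup := h2
    have h3 : SemidirectProduct.inl g.left * SemidirectProduct.inr g.right ∈ U.toSubgroup :=
      U.toSubgroup.mul_mem ha h2'
    rwa [SemidirectProduct.inl_left_mul_inr_right] at h3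
  exact IsProfiniteCompletion.exists_openNormal_comap_eq _ hdense K U.toSubgroup hKU

end Completion

end Literature.AnabelianGeometry.EtaleTheta.SettingModel.Semidirect

end
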